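import Literature.Probability.Percolation.SeededCollar
import Literature.Probability.Percolation.SeededArms
import Literature.Probability.Percolation.Z2HalfPlaneInterlace
import HarnessLib

/-!
# Arms of the collar exploration in a straight boundary window; the two bad patterns are three-arm events

Topic `Probability/Percolation`.  Part of the formalisation of Schramm–Smirnov's mesh-independent
gluing for critical bond percolation on `ℤ²` (O. Schramm, S. Smirnov, *On the scaling limits of
planar percolation*, Ann. Probab. 39 (2011), arXiv:1101.5820, §4, proof of Prop. 4.1, step "Bays and
beaches": "for every bay the endpoints of its mouth are endpoints of interfaces which meet both `β`
and `β'`; thus three alternating crossings land on the arc, and Lemma 6.2 applies").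

We work with the collar exploration `𝒞.seeds` of a collar datum `𝒞 = (K, Far)` (`SeededCollar.lean`)
near a **straight window** of the inner boundary `β'`: in the box of half-width `R₁ + 2` around the
boundary segment `[j, j+m) × {0}` the strip `K` is exactly the upper half-plane and no far site is
present (`CleanWindow`).  There, in lattice-native form:

* `exists_openArm_exit`, `exists_openArm` — a site `(a,0)` of `𝒪` carries an arm of examined open
  edges inside `siteBox a ρ` reaching sup-distance `ρ` (the walk to its far seed, stopped at its
  first exit);
* `exists_dualArm` — a face of `𝒟` in `faceBox b ρ` carries a face walk inside the face box, each
  step crossing an examined closed edge, reaching sup-distance `ρ`;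
* **`threeArm_of_patternOne`** — PATTERN (Q1): sites `(x,0), (x',0) ∈ 𝒪` and a face `(b,0) ∈ 𝒟`
  with `x ≤ b < x'` whose bottom edge is not examined-open; once the legs at `x, x'` are open and
  the bottom edge under `(b,0)` is closed, the configuration lies in `Z2HalfPlane.threeArm j m R`
  (the two open arms are edge-disjoint: an examined-open walk from `(x,0)` to `(x',0)` would trap
  the examined-closed chain from `(b,0)`, `Z2HalfPlane.interlace_of_disjoint`);
* **`threeArm_of_patternTwo`** — PATTERN (Q2): a site `(x,0) ∈ 𝒪` flanked by faces
  `(b₁,0), (b₂,0) ∈ 𝒟`, `b₁ < x ≤ b₂`, with bottom edges not examined-open; with the leg at `x`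
  open and the two bottom edges closed the configuration lies in `threeArm j m R` (the two closed
  chains cross disjoint edges, `Z2HalfPlane.sepEdge_ne_of_openArm`).

These are the deterministic halves of the bound `P(Q1 ∪ Q2) ≤ 16 P(threeArm)`; the inserted edges
(legs, bottom edges of type β) are never examinable, which is what makes the insertion cost a
constant factor (sequel).  Everything is proved; no named fact is introduced.

## References

* O. Schramm, S. Smirnov, Ann. Probab. 39 (2011) 1768–1814, arXiv:1101.5820, §4 and Lemma 6.2.
  [SchrammSmirnov2011]
* G. Lawler, O. Schramm, W. Werner, Electron. J. Probab. 7 (2002), Appendix A (half-plane three-arm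
  events). [LawlerSchrammWernerEJP2002]
-/

noncomputable section

open SimpleGraph

namespace Literature.Probability.Percolation

open LatticeModels Relation Z2HalfPlane

namespace Seeded

namespace CollarDatum

variable (𝒞 : CollarDatum)

/-! ### Straight windows of the inner boundary -/

/-- **A clean straight window**: in the box `[j-R₁-2, j+m+R₁+2] × [-2, R₁+2]` the strip `K` is exactly
the closed upper half-plane and no far site occurs (so the examinable edges there are the edges of
the half-plane, the legs and moat edges are fresh, and no seed is present).
[cite: SchrammSmirnov2011, §4, proof of Prop. 4.1 ("each component K_j is a quad with two long sides on β and β'")] -/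
def CleanWindow (j : ℤ) (m R₁ : ℕ) : Prop :=
  ∀ v : Site 2, j - R₁ - 2 ≤ v 0 → v 0 ≤ j + m + R₁ + 2 → -2 ≤ v 1 → v 1 ≤ R₁ + 2 →
    (v ∈ 𝒞.K ↔ 0 ≤ v 1) ∧ v ∉ 𝒞.Far

variable {𝒞} {j : ℤ} {m R₁ : ℕ} (hW : 𝒞.CleanWindow j m R₁)
include hW

/-- In a clean window, an examinable edge with an endpoint in `[j-R₁-1, j+m+R₁+1] × [-1, R₁+1]` has
all its endpoints at height `≥ 0`. [folklore] -/
theorem CleanWindow.nonneg_of_mem_A {e : Sym2 (Site 2)} (he : e ∈ 𝒞.A) {w : Site 2} (hw : w ∈ e)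
    (hw0 : j - R₁ - 1 ≤ w 0) (hw0' : w 0 ≤ j + m + R₁ + 1) (hw1 : -1 ≤ w 1) (hw1' : w 1 ≤ R₁ + 1) :
    ∀ u ∈ e, 0 ≤ u 1 := by
  have hwK : 0 ≤ w 1 := by
    have h := hW w (by omega) (by omega) (by omega) (by omega)
    rcases 𝒞.mem_or_mem_of_mem_A he hw with hK | hF
    · exact h.1.1 hK
    · exact absurd hF h.2
  intro u hu
  by_cases huw : u = w
  · exact huw ▸ hwK
  · have hadj : (zdGraph 2).Adj u w := by
      have := (𝒞.mem_A_iff.1 he).1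
      rw [(Sym2.mem_and_mem_iff huw).1 ⟨hu, hw⟩] at this
      exact (mem_edgeSet (G := zdGraph 2)).1 this
    have h := hW u (by rcases stepKind_of_adj hadj with ⟨h0, h1⟩ | ⟨h0, h1⟩ | ⟨h1, h0⟩ | ⟨h1, h0⟩ <;> omega)
      (by rcases stepKind_of_adj hadj with ⟨h0, h1⟩ | ⟨h0, h1⟩ | ⟨h1, h0⟩ | ⟨h1, h0⟩ <;> omega)
      (by rcases stepKind_of_adj hadj with ⟨h0, h1⟩ | ⟨h0, h1⟩ | ⟨h1, h0⟩ | ⟨h1, h0⟩ <;> omega)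
      (by rcases stepKind_of_adj hadj with ⟨h0, h1⟩ | ⟨h0, h1⟩ | ⟨h1, h0⟩ | ⟨h1, h0⟩ <;> omega)
    rcases 𝒞.mem_or_mem_of_mem_A he hu with hK | hF
    · exact h.1.1 hK
    · exact absurd hF h.2

/-- In a clean window no seed face (a face with a far corner) has its lower-left corner in
`[j-R₁-2, j+m+R₁+1] × [-2, R₁+1]`. [folklore] -/
theorem CleanWindow.not_mem_D₀ {f : Site 2} (hf0 : j - R₁ - 2 ≤ f 0) (hf0' : f 0 ≤ j + m + R₁ + 1)
    (hf1 : -2 ≤ f 1) (hf1' : f 1 ≤ R₁ + 1) : f ∉ 𝒞.D₀ := by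
  rintro ⟨v, hv, hvF⟩
  have h0 := hv 0
  have h1 := hv 1
  exact (hW v (by omega) (by omega) (by omega) (by omega)).2 hvF

/-- In a clean window no seed site lies in `[j-R₁-2, j+m+R₁+2] × [-2, R₁+2]`. [folklore] -/
theorem CleanWindow.not_mem_Far {v : Site 2} (hv0 : j - R₁ - 2 ≤ v 0) (hv0' : v 0 ≤ j + m + R₁ + 2)
    (hv1 : -2 ≤ v 1) (hv1' : v 1 ≤ R₁ + 2) : v ∉ 𝒞.Far :=
  (hW v hv0 hv0' hv1 hv1').2

/-! ### Open arms from `𝒪` -/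

variable {X : Finset (Sym2 (Site 2))} (hX : X ⊆ 𝒞.A) {ω : BondConfig (Site 2)}
include hX

/-- **Open arm with its exit edge.**  A site `(a,0)` of `𝒪` with `a` in the window carries a walk of
examined open edges inside `siteBox a ρ` (`ρ ≤ R₁`) ending at a site adjacent, through a further
examined open edge, to a site outside the box of height `≥ 0`.
[cite: SchrammSmirnov2011, §4, proof of Prop. 4.1 (the open crossing from the endpoint of a mouth to β)] -/
theorem exists_openArm_exit {a : ℤ} (hja : j ≤ a) (ham : a < j + m) {ρ : ℕ} (hρ : ρ ≤ R₁)
    (hO : OReach 𝒞.seeds X ω ![a, 0]) :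
    ∃ (y z : Site 2) (P : (zdGraph 2).Walk (![a, 0] : Site 2) y),
      (∀ w ∈ P.support, w ∈ siteBox a ρ) ∧ (zdGraph 2).Adj y z ∧ z ∉ siteBox a ρ ∧ 0 ≤ z 1 ∧
      (∀ e ∈ P.edges, e ∈ X ∧ e ∈ ω) ∧ s(y, z) ∈ X ∧ s(y, z) ∈ ω := by
  obtain ⟨s, hs, P₀, hP₀⟩ := exists_walk_of_oReach' (𝔖 := 𝒞.seeds) hX hO
  rw [seeds_O₀] at hs
  have ha : (![a, 0] : Site 2) ∈ (↑(siteBox a ρ) : Set (Site 2)) := by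
    rw [Finset.mem_coe, mem_siteBox]; simp
  have hsbox : s ∉ (↑(siteBox a ρ) : Set (Site 2)) := by
    intro h
    rw [Finset.mem_coe, mem_siteBox] at h
    exact hW.not_mem_Far (by omega) (by omega) (by omega) (by omega) hs
  obtain ⟨y, z, P, hyz, hz, hPS, -, hPE, hyzE⟩ := exists_prefix_exit P₀ ha hsbox
  have hy : y ∈ siteBox a ρ := Finset.mem_coe.1 (hPS y P.end_mem_support)
  rw [mem_siteBox] at hy
  refine ⟨y, z, P, fun w hw => Finset.mem_coe.1 (hPS w hw), hyz, fun h => hz (Finset.mem_coe.2 h), ?_,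
    fun e he => hP₀ e (hPE e he), (hP₀ _ hyzE).1, (hP₀ _ hyzE).2⟩
  exact hW.nonneg_of_mem_A (hX (hP₀ _ hyzE).1) (Sym2.mem_mk_left y z) (by omega) (by omega) (by omega)
    (by omega) z (Sym2.mem_mk_right y z)

/-- **Open arm.**  A site `(a,0)` of `𝒪` with `a` in the window carries a walk of examined open edges
inside `siteBox a ρ` to a site at sup-distance `ρ` (`Z2HalfPlane.Far ρ a`).
[cite: SchrammSmirnov2011, §4, proof of Prop. 4.1 (the open crossing from the endpoint of a mouth to β)] -/
theorem exists_openArm {a : ℤ} (hja : j ≤ a) (ham : a < j + m) {ρ : ℕ} (hρ : ρ ≤ R₁)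
    (hO : OReach 𝒞.seeds X ω ![a, 0]) :
    ∃ (v : Site 2) (P : (zdGraph 2).Walk (![a, 0] : Site 2) v), Z2HalfPlane.Far ρ a v ∧
      (∀ w ∈ P.support, w ∈ siteBox a ρ) ∧ ∀ e ∈ P.edges, e ∈ X ∧ e ∈ ω := by
  obtain ⟨y, z, P, hPS, hyz, hz, hz1, hPE, -, -⟩ := exists_openArm_exit hW hX hja ham hρ hO
  refine ⟨y, P, ?_, hPS, hPE⟩
  have hy := hPS y P.end_mem_support
  rw [mem_siteBox] at hy hz
  unfold Z2HalfPlane.Far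
  rcases stepKind_of_adj hyz with ⟨h0, h1⟩ | ⟨h0, h1⟩ | ⟨h1, h0⟩ | ⟨h1, h0⟩
  · left; rw [le_abs]; omega
  · left; rw [le_abs]; omega
  · right; omega
  · exfalso; omega

/-! ### Closed arms from `𝒟` -/

omit hX in
/-- **Closed (dual) arm.**  A face of `𝒟` inside `faceBox b ρ` (`b` in the window, `ρ ≤ R₁`) carries
a face walk inside the face box, every step of which crosses an examined closed edge, to a face at
sup-distance `ρ` (`Z2HalfPlane.Far ρ b`).
[cite: SchrammSmirnov2011, §4, proof of Prop. 4.1 (the closed crossing from the endpoint of a mouth to β)] -/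
theorem exists_dualArm (hX : X ⊆ 𝒞.A) {b : ℤ} (hjb : j ≤ b) (hbm : b < j + m) {ρ : ℕ} (hρ : ρ ≤ R₁)
    {f : Site 2} (hf : f ∈ faceBox b ρ) (hD : DReach 𝒞.seeds X ω f) :
    ∃ (g : Site 2) (Q : (zdGraph 2).Walk f g), Z2HalfPlane.Far ρ b g ∧ (∀ u ∈ Q.support, u ∈ faceBox b ρ) ∧
      ∀ d ∈ Q.darts, sepEdge d.fst d.snd ∈ X ∧ sepEdge d.fst d.snd ∉ ω := by
  obtain ⟨g₀, hg₀, Q₀, hQ₀⟩ := exists_faceWalk_of_dReach' (𝔖 := 𝒞.seeds) hD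
  rw [seeds_D₀] at hg₀
  have hfS : f ∈ (↑(faceBox b ρ) : Set (Site 2)) := Finset.mem_coe.2 hf
  have hg₀S : g₀ ∉ (↑(faceBox b ρ) : Set (Site 2)) := by
    intro h
    rw [Finset.mem_coe, mem_faceBox] at h
    exact hW.not_mem_D₀ (by omega) (by omega) (by omega) (by omega) hg₀
  obtain ⟨y, z, Q, hyz, hz, hQS, -, hQE, hyzE⟩ := exists_prefix_exit Q₀ hfS hg₀S
  have hy : y ∈ faceBox b ρ := Finset.mem_coe.1 (hQS y Q.end_mem_support)
  rw [mem_faceBox] at hy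
  have hdarts : ∀ d ∈ Q.darts, sepEdge d.fst d.snd ∈ X ∧ sepEdge d.fst d.snd ∉ ω := by
    intro d hd
    obtain ⟨d', hd', heq⟩ := exists_dart_sepEdge_eq Q₀ (hQE _ (by rw [Walk.edges]; exact List.mem_map.2 ⟨d, hd, rfl⟩))
    rw [heq]; exact hQ₀ d' hd'
  -- the exit step crosses an examined edge
  obtain ⟨d', hd', heq⟩ := exists_dart_sepEdge_eq Q₀ (d := ⟨(y, z), hyz⟩) hyzE
  have hsepX : sepEdge y z ∈ X := by
    have := (hQ₀ d' hd').1; rw [← heq] at this; exact this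
  refine ⟨y, Q, ?_, fun u hu => Finset.mem_coe.1 (hQS u hu), hdarts⟩
  have hzbox : ¬ ((b - ρ ≤ z 0 ∧ z 0 ≤ b + ρ) ∧ (-1 ≤ z 1 ∧ z 1 ≤ ρ)) := fun h =>
    hz (Finset.mem_coe.2 (mem_faceBox.2 h))
  unfold Z2HalfPlane.Far
  rcases stepKind_of_adj hyz with ⟨e0, e1⟩ | ⟨e0, e1⟩ | ⟨e1, e0⟩ | ⟨e1, e0⟩
  · left; rw [le_abs]; omega
  · left; rw [le_abs]; omega
  · right; omega
  · -- a downward exit: either from the moat, across an edge of height `-1` (not examinable in a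
    -- clean window), or not an exit at all
    exfalso
    by_cases hy1 : y 1 = -1
    · have hyz' : y = z + Pi.single 1 1 := by
        funext i; fin_cases i <;> simp [e0, e1]
      have hmem : y ∈ sepEdge y z := by
        rw [sepEdge_comm, hyz', sepEdge_up]; exact Sym2.mem_mk_left _ _
      have := hW.nonneg_of_mem_A (hX hsepX) hmem (by omega) (by omega) (by omega) (by omega) y hmem
      omega
    · exact hzbox (by omega)

/-! ### Pattern (Q1): two open contacts with a closed foot between them -/

omit hW hX in
/-- Splicing two walks at a common edge: a walk from the start of the one to the start of the
other using only their edges and sites. [folklore] -/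
theorem exists_walk_of_common_edge {u v u' v' : Site 2} (P : (zdGraph 2).Walk u v) (P' : (zdGraph 2).Walk u' v')
    {e : Sym2 (Site 2)} (he : e ∈ P.edges) (he' : e ∈ P'.edges) :
    ∃ S : (zdGraph 2).Walk u u', (∀ w ∈ S.support, w ∈ P.support ∨ w ∈ P'.support) ∧
      ∀ g ∈ S.edges, g ∈ P.edges ∨ g ∈ P'.edges := by
  induction e using Sym2.ind with
  | _ p q =>
    have hp : p ∈ P.support := P.fst_mem_support_of_mem_edges he
    have hp' : p ∈ P'.support := P'.fst_mem_support_of_mem_edges he'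
    refine ⟨(P.takeUntil p hp).append (P'.takeUntil p hp').reverse, fun w hw => ?_, fun g hg => ?_⟩
    · rw [Walk.support_append, List.mem_append] at hw
      rcases hw with hw | hw
      · exact Or.inl (P.support_takeUntil_subset_support hp hw)
      · have hw' := List.tail_subset _ hw
        rw [Walk.support_reverse, List.mem_reverse] at hw'
        exact Or.inr (P'.support_takeUntil_subset_support hp' hw')
    · rw [Walk.edges_append, List.mem_append, Walk.edges_reverse, List.mem_reverse] at hg
      rcases hg with hg | hg
      · exact Or.inl (P.edges_takeUntil_subset_edges hp hg)
      · exact Or.inr (P'.edges_takeUntil_subset_edges hp' hg)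

/-- **Pattern (Q1) is a three-arm event.**  In a clean window with `R + m + 1 ≤ R₁`, let
`x ≤ b < x'` lie in `[j, j+m)` with `(x,0), (x',0) ∈ 𝒪`, `(b,0) ∈ 𝒟`, and the bottom edge under
`(b,0)` not examined-open.  If moreover the legs at `x`, `x'` are open and the bottom edge under
`(b,0)` is closed, then `ω ∈ threeArm j m R`: open arm from `(x,0)`, closed arm from the moat face
`(b,-1)`, and a second open arm from `(x',0)` edge-disjoint from the first.
[cite: SchrammSmirnov2011, §4, proof of Prop. 4.1 with Lemma 6.2] -/
theorem threeArm_of_patternOne {R : ℕ} (hR : R + m + 1 ≤ R₁) {x b x' : ℤ} (hjx : j ≤ x) (hxb : x ≤ b)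
    (hbx' : b < x') (hx'm : x' < j + m)
    (hOx : OReach 𝒞.seeds X ω ![x, 0]) (hOx' : OReach 𝒞.seeds X ω ![x', 0])
    (hDb : DReach 𝒞.seeds X ω ![b, 0])
    (heb : ¬ (s((![b, 0] : Site 2), ![b + 1, 0]) ∈ X ∧ s((![b, 0] : Site 2), ![b + 1, 0]) ∈ ω))
    (hlx : leg x ∈ ω) (hlx' : leg x' ∈ ω) (hebω : s((![b, 0] : Site 2), ![b + 1, 0]) ∉ ω) :
    ω ∈ threeArm j m R := by
  have hRR₁ : R ≤ R₁ := by omega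
  -- the three arms at radius `R`
  obtain ⟨v, P, hv, hPS, hPE⟩ := exists_openArm hW hX hjx (by omega) hRR₁ hOx
  obtain ⟨v', P', hv', hP'S, hP'E⟩ := exists_openArm hW hX (by omega) hx'm hRR₁ hOx'
  have hbface : (![b, 0] : Site 2) ∈ faceBox b R := by rw [mem_faceBox]; simp
  obtain ⟨g, Q, hg, hQS, hQE⟩ := exists_dualArm hW hX (by omega) (by omega) hRR₁ hbface hDb
  -- the closed arm started in the moat
  set Qm : (zdGraph 2).Walk (![b, -1] : Site 2) g := Walk.cons (adj_leg b) Q with hQm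
  have hQmS : ∀ u ∈ Qm.support, u ∈ faceBox b R := by
    intro u hu
    rw [hQm, Walk.support_cons, List.mem_cons] at hu
    rcases hu with rfl | hu
    · rw [mem_faceBox]; simp
    · exact hQS u hu
  have hQmE : ∀ d ∈ Qm.darts, sepEdge d.fst d.snd ∉ ω := by
    intro d hd
    rw [hQm, Walk.darts_cons, List.mem_cons] at hd
    rcases hd with rfl | hd
    · simpa [sepEdge_moat_up] using hebω
    · exact (hQE d hd).2
  refine ⟨x, b, ⟨hjx, by omega, by omega, by omega⟩, hlx, v, P, hv, hPS, fun e he => (hPE e he).2,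
    g, Qm, hg, hQmS, hQmE, x', ⟨by omega, hx'm⟩, Or.inl ⟨by omega, hlx', v', P', hv', hP'S,
    fun e he => (hP'E e he).2, fun e he' he => ?_⟩⟩
  -- disjointness: a common edge gives an examined-open walk from `(x,0)` to `(x',0)` …
  obtain ⟨S, hSsupp, hSedges⟩ := exists_walk_of_common_edge P P' he he'
  -- … trapping the long examined-closed chain from `(b,0)`
  have hbface₁ : (![b, 0] : Site 2) ∈ faceBox b (R + m + 1) := by rw [mem_faceBox]; simp; omega
  obtain ⟨g₁, Q₁, hg₁, hQ₁S, hQ₁E⟩ := exists_dualArm hW hX (by omega) (by omega) hR hbface₁ hDb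
  have hSbd : ∀ z ∈ S.support, 0 ≤ z 1 ∧ z 1 ≤ (R + m : ℕ) ∧ b - (R + m : ℕ) ≤ z 0 ∧ z 0 ≤ b + (R + m : ℕ) := by
    intro z hz
    rcases hSsupp z hz with h | h
    · have := mem_siteBox.1 (hPS z h); push_cast; omega
    · have := mem_siteBox.1 (hP'S z h); push_cast; omega
  have hSX : ∀ g ∈ S.edges, g ∈ X ∧ g ∈ ω := fun g hg => (hSedges g hg).elim (hPE g) (hP'E g)
  have key := interlace_row_of_disjoint hxb hbx' (x₀ := b) (M := R + m) S hSbd Q₁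
    (fun d hd h => (hQ₁E d hd).2 (hSX _ h).2)
    (fun d hd h => ?_) (fun d hd h => ?_) (fun u hu => (mem_faceBox.1 (hQ₁S u hu)).2.1)
    (fun h => heb (hSX _ h))
  · rcases hg₁ with hfar | hfar
    · have := le_abs.1 hfar; push_cast at key this; omega
    · push_cast at key; omega
  -- examined edges crossed in the window are not legs
  all_goals
    have hmemX := (hQ₁E d hd).1
    rw [h] at hmemX
    have hu := mem_faceBox.1 (hQ₁S _ (Q₁.dart_fst_mem_support_of_mem_darts hd))
    have := hW.nonneg_of_mem_A (hX hmemX) (Sym2.mem_mk_left _ _) (by simp; omega) (by simp; omega)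
      (by simp) (by simp; omega) _ (Sym2.mem_mk_left _ _)
    simp at this

/-! ### Pattern (Q2): an open contact flanked by two closed feet -/

/-- **Pattern (Q2) is a three-arm event.**  In a clean window with `R + m + 1 ≤ R₁`, let
`b₁ < x ≤ b₂` lie in `[j, j+m)` with `(x,0) ∈ 𝒪`, `(b₁,0), (b₂,0) ∈ 𝒟`, and the bottom edges under
these two faces not examined-open.  If moreover the leg at `x` is open and the two bottom edges are
closed, then `ω ∈ threeArm j m R`: open arm from `(x,0)`, closed arm from `(b₂,-1)`, and a second
closed arm from `(b₁,-1)` crossing edges none of which is crossed by the first.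
[cite: SchrammSmirnov2011, §4, proof of Prop. 4.1 with Lemma 6.2] -/
theorem threeArm_of_patternTwo {R : ℕ} (hR : R + m + 1 ≤ R₁) {b₁ x b₂ : ℤ} (hjb₁ : j ≤ b₁) (hb₁x : b₁ < x)
    (hxb₂ : x ≤ b₂) (hb₂m : b₂ < j + m)
    (hOx : OReach 𝒞.seeds X ω ![x, 0])
    (hD₁ : DReach 𝒞.seeds X ω ![b₁, 0]) (hD₂ : DReach 𝒞.seeds X ω ![b₂, 0])
    (he₁ : ¬ (s((![b₁, 0] : Site 2), ![b₁ + 1, 0]) ∈ X ∧ s((![b₁, 0] : Site 2), ![b₁ + 1, 0]) ∈ ω))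
    (he₂ : ¬ (s((![b₂, 0] : Site 2), ![b₂ + 1, 0]) ∈ X ∧ s((![b₂, 0] : Site 2), ![b₂ + 1, 0]) ∈ ω))
    (hlx : leg x ∈ ω) (he₁ω : s((![b₁, 0] : Site 2), ![b₁ + 1, 0]) ∉ ω)
    (he₂ω : s((![b₂, 0] : Site 2), ![b₂ + 1, 0]) ∉ ω) :
    ω ∈ threeArm j m R := by
  have hRR₁ : R ≤ R₁ := by omega
  -- the open arm at radius `R` and the two closed arms at radius `R`, started in the moat
  obtain ⟨v, P, hv, hPS, hPE⟩ := exists_openArm hW hX (by omega) (by omega) hRR₁ hOx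
  have hface₁ : (![b₁, 0] : Site 2) ∈ faceBox b₁ R := by rw [mem_faceBox]; simp
  have hface₂ : (![b₂, 0] : Site 2) ∈ faceBox b₂ R := by rw [mem_faceBox]; simp
  obtain ⟨g₁, Q₁, hg₁, hQ₁S, hQ₁E⟩ := exists_dualArm hW hX hjb₁ (by omega) hRR₁ hface₁ hD₁
  obtain ⟨g₂, Q₂, hg₂, hQ₂S, hQ₂E⟩ := exists_dualArm hW hX (by omega) hb₂m hRR₁ hface₂ hD₂
  set Qm₁ : (zdGraph 2).Walk (![b₁, -1] : Site 2) g₁ := Walk.cons (adj_leg b₁) Q₁ with hQm₁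
  set Qm₂ : (zdGraph 2).Walk (![b₂, -1] : Site 2) g₂ := Walk.cons (adj_leg b₂) Q₂ with hQm₂
  have hQm₁S : ∀ u ∈ Qm₁.support, u ∈ faceBox b₁ R := by
    intro u hu
    rw [hQm₁, Walk.support_cons, List.mem_cons] at hu
    rcases hu with rfl | hu
    · rw [mem_faceBox]; simp
    · exact hQ₁S u hu
  have hQm₂S : ∀ u ∈ Qm₂.support, u ∈ faceBox b₂ R := by
    intro u hu
    rw [hQm₂, Walk.support_cons, List.mem_cons] at hu
    rcases hu with rfl | hu
    · rw [mem_faceBox]; simp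
    · exact hQ₂S u hu
  -- crossed edges: closed, and either a bottom edge under a start face or examined-closed
  have hQm₁E : ∀ d ∈ Qm₁.darts, sepEdge d.fst d.snd ∉ ω ∧
      (sepEdge d.fst d.snd = s((![b₁, 0] : Site 2), ![b₁ + 1, 0]) ∨ sepEdge d.fst d.snd ∈ X) := by
    intro d hd
    rw [hQm₁, Walk.darts_cons, List.mem_cons] at hd
    rcases hd with rfl | hd
    · simp [sepEdge_moat_up, he₁ω]
    · exact ⟨(hQ₁E d hd).2, Or.inr (hQ₁E d hd).1⟩
  have hQm₂E : ∀ d ∈ Qm₂.darts, sepEdge d.fst d.snd ∉ ω ∧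
      (sepEdge d.fst d.snd = s((![b₂, 0] : Site 2), ![b₂ + 1, 0]) ∨ sepEdge d.fst d.snd ∈ X) := by
    intro d hd
    rw [hQm₂, Walk.darts_cons, List.mem_cons] at hd
    rcases hd with rfl | hd
    · simp [sepEdge_moat_up, he₂ω]
    · exact ⟨(hQ₂E d hd).2, Or.inr (hQ₂E d hd).1⟩
  refine ⟨x, b₂, ⟨by omega, by omega, by omega, hb₂m⟩, hlx, v, P, hv, hPS, fun e he => (hPE e he).2,
    g₂, Qm₂, hg₂, hQm₂S, fun d hd => (hQm₂E d hd).1, b₁, ⟨hjb₁, by omega⟩,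
    Or.inr ⟨g₁, Qm₁, hg₁, hQm₁S, fun d hd => (hQm₁E d hd).1, ?_⟩⟩
  -- disjointness of the two closed arms: the long open arm from `(x,0)` separates them
  obtain ⟨y, z, P₁, hP₁S, hyz, hz, hz1, hP₁E, hyzX, hyzω⟩ :=
    exists_openArm_exit hW hX (a := x) (by omega) (by omega) (ρ := R + m + 1) hR hOx
  -- crossed edges avoid the open arm, its exit edge and its leg
  have havoid : ∀ {bᵢ : ℤ} {gᵢ : Site 2} (Qᵢ : (zdGraph 2).Walk (![bᵢ, -1] : Site 2) gᵢ),
      j ≤ bᵢ → bᵢ < j + m →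
      (∀ u ∈ Qᵢ.support, u ∈ faceBox bᵢ R) →
      (¬ (s((![bᵢ, 0] : Site 2), ![bᵢ + 1, 0]) ∈ X ∧ s((![bᵢ, 0] : Site 2), ![bᵢ + 1, 0]) ∈ ω)) →
      (∀ d ∈ Qᵢ.darts, sepEdge d.fst d.snd ∉ ω ∧
        (sepEdge d.fst d.snd = s((![bᵢ, 0] : Site 2), ![bᵢ + 1, 0]) ∨ sepEdge d.fst d.snd ∈ X)) →
      ∀ d ∈ Qᵢ.darts, sepEdge d.fst d.snd ∉ P₁.edges ∧ sepEdge d.fst d.snd ≠ s(y, z) ∧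
        sepEdge d.fst d.snd ≠ leg x := by
    intro bᵢ gᵢ Qᵢ hjbᵢ hbᵢm hQᵢS heᵢ hQᵢE d hd
    obtain ⟨hclosed, hwhich⟩ := hQᵢE d hd
    refine ⟨fun h => hclosed (hP₁E _ h).2, fun h => hclosed (h ▸ hyzω), fun h => ?_⟩
    rcases hwhich with hbot | hXd
    · exact bottomEdge_ne_leg bᵢ x (hbot ▸ h)
    · rw [h] at hXd
      have hu := mem_faceBox.1 (hQᵢS _ (Qᵢ.dart_fst_mem_support_of_mem_darts hd))
      have := hW.nonneg_of_mem_A (hX hXd) (Sym2.mem_mk_left _ _) (by simp; omega) (by simp; omega)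
        (by simp) (by simp; omega) _ (Sym2.mem_mk_left _ _)
      simp at this
  refine sepEdge_ne_of_openArm hb₁x hxb₂ (R := R) (R₁ := R + m + 1) (by omega) P₁
    (fun w hw => ?_) hyz (fun h => hz (mem_siteBox.2 ?_)) hz1 Qm₁ Qm₂ (fun u hu => ?_) (fun u hu => ?_)
    (havoid Qm₁ hjb₁ (by omega) hQm₁S he₁ hQm₁E) (havoid Qm₂ (by omega) hb₂m hQm₂S he₂ hQm₂E)
  · have := mem_siteBox.1 (hP₁S w hw); push_cast at this ⊢; omega
  · push_cast at h ⊢; omega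
  · have := mem_faceBox.1 (hQm₁S u hu); push_cast at this ⊢; omega
  · have := mem_faceBox.1 (hQm₂S u hu); push_cast at this ⊢; omega

end CollarDatum

end Seeded

end Literature.Probability.Percolation
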